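import Summits.HubbardSuperconductivity.HubbardSuperconductivity.Theorems.AnisotropyChordTransferFibre3FinX5SoundB

/-!
# Route `AnisotropyChord` / H0 rotor rung: FIN per-`L` GM₃ — the TWO-LEVEL cell list (X6): rows `N₁`/C on coarse cells, rows D/side on fine sub-cells

The per-`L` GM₃ certificate of `…FinX5Eval`/`…FinX5SoundB` (`gmCheck5`) reads all four kernel cell facts (rows `N₁`, C, D and the
regime/side condition) on the SAME `λ₂`-cell.  Measured (prover seat `hubbard-h0-rotor-p3` g9, `L = 38`): the row-D constant `a_D` of the
zero-order monotone evaluator is width-proportional (`a_D ≈ .08` on 2.4 % cells, `.15` on 4.8 % cells) while the row-`N₁` constant `c`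
and the row-C constant `b` move by less than 3 % — and rows `N₁`/C (two-propagator and Green point wedges, profile/gradient tables,
row-C sums) carry almost all of the kernel cost.  This file lets a certificate use COARSE cells for rows `N₁`/C and FINE sub-cells for
row D and the side condition:

* `GSub`, `GCell6` — a coarse cell `[a.lam, nx]` with its row-`N₁`/C data (`c`, `bn`, brackets `nt ⊇ (T⁺ − 3λ₂)·D`, `tb ⊇ T⁺·D`) and the
  list of fine sub-cells (start point, row-D constant `aD`), the first sub-cell starting at `a.lam`, the last ending at `nx`;
* `subsAll6` — every fine sub-cell passes `xdCellAnyN0` (row D, reads `nt`) and `sdCellAnyZN` (side condition with `(c, bn, aD)`, reads `nt`);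
* `gmCellOK6` — the coarse pair passes `xbnCellAny2` (row `N₁`, exporting `nt`, `tb`) and `xcCellAnyA0` (row C) and its sub-cells pass;
* `cellsAllG6`, `gmCheck6` — the per-`L` certificate; ★ `gm3_of_gmCellOK6`, ★★★ `gm3_of_gmCheck6`: `GM3Fibre L Δ` for every
  `0 < Δ ≤ Δ₁ < 1` (`9 ≤ L`).  Soundness is that of `gm3_of_gmCellOK5` verbatim, the coarse facts being instantiated on the enclosing
  cell (`a.lam ≤ p ≤ λ₂·D ≤ p' ≤ nx`): the exported bracket `nt` is a statement about the ground profile, not about the cell.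
Prover seat `hubbard-h0-rotor-p3` g9; helper for piece A = stmt-HubbardSuperconductivity-23918 of rung 19089 (`--supports`, helper
class).  WHAT THIS IS NOT: nothing here proves superconductivity in the Hubbard model (rotor TARGET as worded stays FALSE, g15 verdict);
glue for the per-`L` GM₃ input of ONE conditional reduction.  Tree imports only; no sorry, no new axioms.
-/

set_option linter.dupNamespace false
set_option autoImplicit false

namespace Summit.HubbardSuperconductivity.HubbardSuperconductivity.Theorems.AnisotropyChord.Transfer.Fibre3

namespace FinXD

open scoped BigOperators
open Finset Hole2 FinCell FinXB

/-! ## The two-level cell list -/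

/-- a fine sub-cell: its start point `λ·D` and its row-D constant. -/
structure GSub where
  /-- `λ·D` of the start point -/
  lam : ℤ
  /-- row-D constant on the sub-cell starting here -/
  aD : ℚ

/-- a coarse cell of the two-level GM₃ certificate: row-`N₁`/C data and the fine sub-cells (the first starts at `lam`). -/
structure GCell6 where
  /-- `λ·D` of the coarse start point -/
  lam : ℤ
  /-- row-`N₁` constant -/
  c : ℚ
  /-- row-C numerator (`b = bn/bd`) -/
  bn : ℕ
  /-- `(T⁺ − 3λ₂)·D` lower end -/
  nlo : ℤ
  /-- `(T⁺ − 3λ₂)·D` upper end -/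
  nhi : ℤ
  /-- `T⁺·D` lower end -/
  tlo : ℤ
  /-- `T⁺·D` upper end -/
  thi : ℤ
  /-- the fine sub-cells (start point, `aD`), increasing, the first at `lam` -/
  subs : List GSub

/-- every fine sub-cell (consecutive starts, the last one ending at the coarse end `nx`) passes rows D and side with the coarse
`(c, bn)` and the coarse bracket `nt`. -/
def subsAll6 (L : ℕ) (d1 : ℚ) (bd : ℕ) (c : ℚ) (bn : ℕ) (nt : Iv) : List GSub → ℤ → Bool
  | [], _ => false
  | [s], nx => xdCellAnyN0 L d1 s.lam nx s.aD nt && sdCellAnyZN L d1 bd s.lam nx (c, bn, s.aD) nt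
  | s :: t :: rest, nx =>
      xdCellAnyN0 L d1 s.lam t.lam s.aD nt && sdCellAnyZN L d1 bd s.lam t.lam (c, bn, s.aD) nt && subsAll6 L d1 bd c bn nt (t :: rest) nx

/-- ★ the per-pair check (X6 form): rows `N₁` and C on the coarse pair, rows D / side on its fine sub-cells, the first of which starts at `a.lam`. -/
def gmCellOK6 (L : ℕ) (d1 : ℚ) (bd : ℕ) (a : GCell6) (nx : ℤ) : Bool :=
  decide ((a.subs.head?.map GSub.lam) = some a.lam) &&
    xbnCellAny2 L d1 a.lam nx a.c (a.nlo, a.nhi) (a.tlo, a.thi) && xcCellAnyA0 L d1 bd a.lam nx a.bn (a.tlo, a.thi) &&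
    subsAll6 L d1 bd a.c a.bn (a.nlo, a.nhi) a.subs nx

/-- all consecutive coarse pairs pass (X6 form). -/
def cellsAllG6 (L : ℕ) (d1 : ℚ) (bd : ℕ) : List GCell6 → Bool
  | [] => true
  | [_] => true
  | a :: b :: rest => gmCellOK6 L d1 bd a b.lam && cellsAllG6 L d1 bd (b :: rest)

/-- `λ·D` of the last coarse point. -/
def cellsLastG6 : List GCell6 → ℤ
  | [] => 0
  | [a] => a.lam
  | _ :: b :: rest => cellsLastG6 (b :: rest)

/-- ★ THE PER-`L` GM₃ CERTIFICATE (X6 two-level form) on `0 < Δ ≤ Δ₁`: coarse points start at `0`, end `≥ lamTop L`, `0 < bd`, every pair passes. -/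
def gmCheck6 (L : ℕ) (d1 : ℚ) (bd : ℕ) (cells : List GCell6) : Bool :=
  decide ((cells.head?.map GCell6.lam) = some 0) && decide (2 ≤ cells.length) && decide (lamTop L ≤ cellsLastG6 cells)
    && decide (0 < bd) && cellsAllG6 L d1 bd cells

/-! ## Soundness -/

/-- chunking lemma (X6 form). [folklore] -/
theorem cellsAllG6_cons_append (L : ℕ) (d1 : ℚ) (bd : ℕ) {x y : GCell6} {xs ys : List GCell6}
    (h1 : cellsAllG6 L d1 bd (x :: (xs ++ [y])) = true) (h2 : cellsAllG6 L d1 bd (y :: ys) = true) :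
    cellsAllG6 L d1 bd (x :: (xs ++ y :: ys)) = true := by
  induction xs generalizing x with
  | nil =>
    simp only [List.nil_append, cellsAllG6, Bool.and_eq_true] at h1 ⊢
    exact ⟨h1.1, h2⟩
  | cons z zs ih =>
    simp only [List.cons_append, cellsAllG6, Bool.and_eq_true] at h1 ⊢
    exact ⟨h1.1, ih h1.2⟩

/-- the inner cover: a point of `[s.lam, nx]` lies in a fine sub-cell carrying its two facts. [folklore] -/
theorem cover_subs6 (L : ℕ) (d1 : ℚ) (bd : ℕ) (c : ℚ) (bn : ℕ) (nt : Iv) : ∀ (rest : List GSub) (s : GSub) (nx : ℤ) (x : ℝ),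
    subsAll6 L d1 bd c bn nt (s :: rest) nx = true → (s.lam : ℝ) ≤ x → x ≤ (nx : ℝ) →
    ∃ p p' : ℤ, ∃ aD : ℚ, xdCellAnyN0 L d1 p p' aD nt = true ∧ sdCellAnyZN L d1 bd p p' (c, bn, aD) nt = true ∧
      (p : ℝ) ≤ x ∧ x ≤ (p' : ℝ) := by
  intro rest
  induction rest with
  | nil =>
    intro s nx x h hsx hxn
    simp only [subsAll6, Bool.and_eq_true] at h
    exact ⟨s.lam, nx, s.aD, h.1, h.2, hsx, hxn⟩
  | cons t rest ih =>
    intro s nx x h hsx hxn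
    rw [show subsAll6 L d1 bd c bn nt (s :: t :: rest) nx =
        (xdCellAnyN0 L d1 s.lam t.lam s.aD nt && sdCellAnyZN L d1 bd s.lam t.lam (c, bn, s.aD) nt &&
          subsAll6 L d1 bd c bn nt (t :: rest) nx) from rfl, Bool.and_eq_true, Bool.and_eq_true] at h
    obtain ⟨⟨h1, h2⟩, h3⟩ := h
    by_cases hxt : x ≤ (t.lam : ℝ)
    · exact ⟨s.lam, t.lam, s.aD, h1, h2, hsx, hxt⟩
    · exact ih t nx x h3 (le_of_lt (lt_of_not_ge hxt)) hxn

/-- the arithmetic cover (X6 form). [folklore] -/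
theorem cover_allG6 (L : ℕ) (d1 : ℚ) (bd : ℕ) : ∀ (rest : List GCell6) (a b : GCell6) (x : ℝ),
    cellsAllG6 L d1 bd (a :: b :: rest) = true → (a.lam : ℝ) ≤ x → x ≤ ((cellsLastG6 (a :: b :: rest) : ℤ) : ℝ) →
    ∃ g : GCell6, ∃ nx : ℤ, gmCellOK6 L d1 bd g nx = true ∧ (g.lam : ℝ) ≤ x ∧ x ≤ (nx : ℝ) := by
  intro rest
  induction rest with
  | nil =>
    intro a b x h hax hxl
    simp only [cellsAllG6, Bool.and_true] at h
    exact ⟨a, b.lam, h, hax, by simpa [cellsLastG6] using hxl⟩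
  | cons c rest ih =>
    intro a b x h hax hxl
    rw [show cellsAllG6 L d1 bd (a :: b :: c :: rest) = (gmCellOK6 L d1 bd a b.lam && cellsAllG6 L d1 bd (b :: c :: rest)) from rfl,
      Bool.and_eq_true] at h
    obtain ⟨h1, h2⟩ := h
    by_cases hxb : x ≤ (b.lam : ℝ)
    · exact ⟨a, b.lam, h1, hax, hxb⟩
    · have hbx : (b.lam : ℝ) ≤ x := le_of_lt (lt_of_not_ge hxb)
      have hl : cellsLastG6 (a :: b :: c :: rest) = cellsLastG6 (b :: c :: rest) := rfl
      rw [hl] at hxl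
      exact ih b c x h2 hbx hxl

/-- ★ one GM₃ coarse pair (X6 form): the ground profile with `λ₂·D ∈ [g.lam, nx]` yields `GM3Fibre L Δ` (`9 ≤ L`, `0 < Δ ≤ Δ₁ < 1`):
rows `N₁`/C from the coarse facts, rows D/side from the fine sub-cell containing `λ₂·D`. [folklore] -/
theorem gm3_of_gmCellOK6 (L : ℕ) [NeZero L] (hL : 9 ≤ L) {d1 : ℚ} {bd : ℕ} (hbd : 0 < bd) {Δ lam2 : ℝ}
    (hΔ0 : 0 < Δ) (hΔd : Δ ≤ (d1 : ℝ)) (hΔ1 : Δ < 1) {f : Tor L → ℝ} (hf : IsGroundTwoMagnon L Δ lam2 f)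
    {g : GCell6} {nx : ℤ} (hok : gmCellOK6 L d1 bd g nx = true)
    (hlo : (g.lam : ℝ) ≤ lam2 * ((D : ℤ) : ℝ)) (hhi : lam2 * ((D : ℤ) : ℝ) ≤ (nx : ℝ)) : GM3Fibre L Δ := by
  have hL5 : 5 ≤ L := by omega
  unfold gmCellOK6 at hok
  simp only [Bool.and_eq_true, decide_eq_true_eq] at hok
  obtain ⟨⟨⟨hhead, hN⟩, hC⟩, hsubs⟩ := hok
  -- the sub-cell list is nonempty and starts at `g.lam`
  obtain ⟨s, rest, hsr, hs⟩ : ∃ s : GSub, ∃ rest : List GSub, g.subs = s :: rest ∧ s.lam = g.lam := by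
    match hg : g.subs, hhead with
    | s :: rest, h => exact ⟨s, rest, rfl, by simpa [hg] using h⟩
  rw [hsr] at hsubs
  obtain ⟨p, p', aD, hD', hS, hpx, hxp⟩ :=
    cover_subs6 L d1 bd g.c g.bn (g.nlo, g.nhi) rest s nx _ hsubs (by rw [hs]; exact hlo) hhi
  -- row `N₁` with the two exports (coarse cell)
  obtain ⟨hN1, hnt, hTlo, hThi⟩ := xbn_cellAny_sound L hL5 hΔ0 hΔd hΔ1 hf hlo hhi hN
  -- row C reads the `T⁺` brackets (coarse cell); row D and the side condition read `nt` (fine sub-cell)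
  have hCC := xc_cellAny_soundA L hL5 hΔ0 hΔd hΔ1 hf hlo hhi hTlo hThi hC
  have hrowD := xdN_cellAny_sound L hL hΔ0 hΔd hΔ1 hf hpx hxp hnt hD'
  obtain ⟨hm, hside⟩ := sdzN_cellAny_sound L hL5 hΔ0 hΔd hΔ1 hf hpx hxp hnt hS
  have huniq : ∀ lam2' : ℝ, ∀ f' : Tor L → ℝ, IsGroundTwoMagnon L Δ lam2' f' → lam2' = lam2 ∧ f' = f := by
    intro lam2' f' hf'
    have hl : lam2' = lam2 := ground_lam2_unique L (by omega) hf' hf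
    subst hl
    exact ⟨rfl, by rw [ground_eq_explicit L hL5 hΔ0.le hΔ1 hf', ground_eq_explicit L hL5 hΔ0.le hΔ1 hf]⟩
  have hKT1 : TrialGapAbs L Δ g.c := by
    intro lam2' f' hf'
    obtain ⟨rfl, rfl⟩ := huniq lam2' f' hf'
    exact hN1
  have hKT2a : LowShellGFormAbs L Δ aD := by
    intro lam2' f' hf'
    obtain ⟨rfl, rfl⟩ := huniq lam2' f' hf'
    exact hrowD
  have hbdR : (0 : ℝ) < bd := by exact_mod_cast hbd
  have hKT2b : OffPoleTailAbs L Δ ((g.bn : ℝ) / bd) := by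
    refine KT2Assembly.offPoleTailAbs_of_brackets L (by omega) hΔ1 (by positivity) ?_
    intro lam2' f' hf'
    obtain ⟨rfl, rfl⟩ := huniq lam2' f' hf'
    exact hCC
  have hT2 := Tplus_lt_of_mHole_nonneg L (by omega) hm
  have hside' : facMI L Δ f * etaEff L lam2 * ((aD : ℝ) + ((g.bn : ℝ) / bd) / (2 + Real.cos (2 * Real.pi / L))) < (g.c : ℝ) := by
    simpa using hside
  exact gm3_closedRho_twoHoleGap L (by omega) hΔ0 hΔ1 (g.c : ℝ) (aD : ℝ) ((g.bn : ℝ) / bd)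
    (Hole2.twoHoleGap_threeQuarter L hL) hf hT2 hm hside' hKT1 hKT2a hKT2b

/-- ★★★ **GM₃ AT THIS `L` FROM THE TWO-LEVEL KERNEL CELL FACTS (X6 form)**: `gmCheck6 L Δ₁ bd cells = true` (`9 ≤ L`) ⟹ `GM3Fibre L Δ`
for every `0 < Δ ≤ Δ₁`, `Δ < 1`. -/
theorem gm3_of_gmCheck6 (L : ℕ) [NeZero L] (hL : 9 ≤ L) {d1 : ℚ} {bd : ℕ} {cells : List GCell6}
    (h : gmCheck6 L d1 bd cells = true) {Δ : ℝ} (hΔ0 : 0 < Δ) (hΔd : Δ ≤ (d1 : ℝ)) (hΔ1 : Δ < 1) : GM3Fibre L Δ := by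
  obtain ⟨lam2, f, hf⟩ := exists_ground L (by omega) Δ
  have hD := D_pos
  unfold gmCheck6 at h
  simp only [Bool.and_eq_true, decide_eq_true_eq] at h
  obtain ⟨⟨⟨⟨hhead, hlen⟩, htop⟩, hbd⟩, hok⟩ := h
  obtain ⟨a, b, rest, hcells⟩ : ∃ a b : GCell6, ∃ rest : List GCell6, cells = a :: b :: rest := by
    match cells, hlen with
    | a :: b :: rest, _ => exact ⟨a, b, rest, rfl⟩
  subst hcells
  have ha0 : a.lam = 0 := by simpa using hhead
  have hwin := forall_ground_of_window_7 L (by omega) hΔ0.le hΔ1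
    (fun lam2' (f' : Tor L → ℝ) => lam2' = lam2 → GM3Fibre L Δ) ?_
  · exact hwin lam2 f hf rfl
  intro lam2' f' hf' hlam0 hlamle hEq
  subst hEq
  set x : ℝ := lam2' * ((D : ℤ) : ℝ) with hx
  have hx0 : (a.lam : ℝ) ≤ x := by rw [ha0, hx]; push_cast; positivity
  have hxtop : x ≤ ((cellsLastG6 (a :: b :: rest) : ℤ) : ℝ) :=
    (lam_mul_D_le_lamTop L (by omega) hlamle).trans (by exact_mod_cast htop)
  obtain ⟨g, nx, hcell, hgx, hxn⟩ := cover_allG6 L d1 bd rest a b x hok hx0 hxtop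
  exact gm3_of_gmCellOK6 L hL hbd hΔ0 hΔd hΔ1 hf' hcell hgx hxn

end FinXD

end Summit.HubbardSuperconductivity.HubbardSuperconductivity.Theorems.AnisotropyChord.Transfer.Fibre3
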